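import Summits.QuantumFields.BalabanUV.Beta.FP.TorusCompositeCovarianceTwoStep

/-!
# `BalabanUV.Beta.FP.TorusCompositeCovarianceTwo` — road «FP» for binder row D1, ROUTE T, the OWNER d1-p3's SPEC-27 «THE (j, m) TORUS CALL FOR m ≥ 2»,
# **(COV-m) ORDER 2 AT EVERY DEPTH, PART 2 — THE COMPOSITE SECOND-ORDER INSERTION JET BY THE (♭) SECOND CHAIN RULE AND ITS GAUGE-COVARIANCE LAW ON ALL
# COLUMNS**: `compIns₂ … n h · D_finest = 2•compIns₁ … n h · Tip(h) − compRows … n · Tip(h⊙h) + σ_n⁻¹•Far_n((compRows … n · h)⊙(compRows … n · h))`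
# (the `c2 ∕ d2` binders of the composite torus call #21 follow in PART 3 by reading this law through the tower generators)

WHY (g24 HANDOFF OPEN (3); MEMO-g24 §3 (ii); my g25 ONLINE E-1).  As at order 1 (C1): an1's records hold ONE-STEP tables, so the composite SECOND-order insertion jet
of the `n`-fold averaging is DEFINED by a recursion over the one-step jets — the second chain rule of `C^{(n+1)} = C_top ∘ C^{(n)}`: the top step's SECOND jet along
the transported direction, TWICE the top step's first jet composed with the lower composite's first jet (polarisation of the diagonal), and the top rows on the lower
composite's second jet.  NO summand inserts the lower composite's second jet into the top step's FIRST jet (the ♭ shape, MEMO §3 (ii)): against the finest gradient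
such a summand would leave a contact on the iterated roots of NON-root points — columns the lower generators see — which nothing cancels (E-1); with the three
summands displayed the lower-far contacts cancel level by level EXACTLY (because `(Lc^{d+1}·stepScale)⁻¹·(stepScale·#B) = 1`, `#B = Lc^{d+1}`) and the law closes
with the PURE SQUARE far-root weight `σ_n⁻¹·(compRows·h)²` — at `n = 1` T3's `Db₂ = c_j³(Q₁₀h)²` in the rooted presentation.

WHAT.  [our object — bookkeeping] **`compIns₂ Lc M lev rs n h`** — `0` at depth `0`; at depth `n+1`: `(θ_n∕σ_n) • stepIns₂ M Lc (rs 1) (C_n h) · C_n + (2θ_n) • stepIns₁ M Lc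
(rs 1) (C_n h) · compIns₁^{low} h + Qstep · compIns₂^{low} h` (`C_n = compRows^{low}`, `σ_n = ∏_{i<n} stepScale d Lc (lev (i+2))·#B`, `θ_n = Lc^{d+1}·stepScale d Lc (lev 1) ∕
σ_n` — C1's `θ_n`); unfoldings `compIns₂_zero ∕ _succ ∕ _one`; [folklore] `card_box_cast`, and **`compIns₂_mul_tgrad`** (induction; step `compIns₂_mul_tgrad_step` over
C1's `compRows_mul_tgrad`, `compIns₁_mul_tgrad`, `stepIns₁_mul_tgrad` and PART 1's `stepIns₂_mul_tgrad`): `compIns₂ n h · D_finest = 2 • (compIns₁ n h · Tip(h)) − compRows n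
· Tip(h⊙h) + σ_n⁻¹ • Far_n((compRows n · h)⊙(compRows n · h))`, `Tip(v)(b, s) = v b·[s ≡ b.1 + e_{b.2}]` on the finest torus, `Far_n(v)(a, s) = v a·[s = itRoot n (a.1 +
e_{a.2})]` (C1's letters; `σ_n = ∏_{i<n} stepScale d Lc (lev (i+1))·#B`).  One bookkeeping def + [folklore] finite sums BY NAME; no `def … : Prop`, nothing cited, 0 sorry.
Nothing of the dictionary ∕ Bałaban's asserted: that Bałaban's `m`-fold averaging's second jet IS this recursion is an2's TABLE word ∕ PART THREE's junction (R-D1-g44-3);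
filed AS CANDIDATE exactly like U23♭ (R-FP-63 (v)).

HONEST DEPENDENCY (page 1, mandatory): continuum YM on T⁴ ⇐ BetaPertH ∧ nine spine estimates (0/9 proved); BetaPertH ⇐ (D1) ∧ (D4) ∧ CAP+tail;
G-an2-4 gates asym, D1 and NE2/3/4.  HONEST FRAMING (cell contract, verbatim): «discharging `BetaPertH` makes Bałaban's UV stability UNCONDITIONAL —
a real constructive-QFT result; it is NOT the continuum limit and NOT the Clay problem.»  ABSOLUTE RULE (cell charter, verbatim): «No internally-minted
statement may enter as a cited fact. Every hypothesis is either kernel-proved in this package or a verbatim quotation of a PUBLISHED theorem with page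
reference. The manuscript(s) under audit are NOT citable for their own disputed steps — they are the thing under adjudication; programme-internal
(2001/route/tribunal) claims are never citable.»  0 estimates; 0∕4 row-D1 binders; NOT (T-ID), NOT SDF, NOT D1, NOT BetaPertH, NOT continuum, NOT Clay.
D1 formalisation swarm LEAF PROVER 02 (b2b-balaban-beta-d1-formalise-leaf-02 gen 25), 2026-08-23.  No existing file touched.
-/

noncomputable section

open scoped BigOperators

namespace Summit.QuantumFields.BalabanUV.Beta.FP.TorusCompositeCovarianceTwo

open Matrix Finset
open Literature.MathematicalPhysics.QuantumFieldTheory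
open Literature.MathematicalPhysics.QuantumFieldTheory.Balaban1983to89
open Literature.MathematicalPhysics.QuantumFieldTheory.Balaban1983to89.Beta
open B5Prop11Plancherel (fine)
open B6Lemma24Torus (pbox mem_pbox)
open AffineAveraging (Site box toSite unitVec)
open OneStepResolventKernel (Fib)
open Summit.QuantumFields.BalabanUV.Beta.BorderedHessian (stepScale stepScale_ne_zero)
open Summit.QuantumFields.BalabanUV.Beta.FP.KernelPeriodisationFib (Idx)
open Summit.QuantumFields.BalabanUV.Beta.FP.TorusGaugeCovariance (tdelta tgrad)
open Summit.QuantumFields.BalabanUV.Beta.FP.TorusGaugeCovariancePairing (wrapPt wrapPt_of_mem)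
open Summit.QuantumFields.BalabanUV.Beta.FP.TorusCompositeObjects
open Summit.QuantumFields.BalabanUV.Beta.FP.TorusCompositeCovariance (rootPt itRoot itRoot_zero itRoot_succ)
open Summit.QuantumFields.BalabanUV.Beta.FP.TorusCompositeCovarianceOne (tdelta_wrapPt of_tdelta_mul stepIns₁ stepIns₁_mul_tgrad compIns₁ compRows_mul_tgrad
  prod_stepScale_mul_card_ne_zero' compIns₁_mul_tgrad)
open Summit.QuantumFields.BalabanUV.Beta.FP.TorusCompositeCovarianceTwoStep (stepIns₂ stepIns₂_mul_tgrad)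

variable {d : ℕ}

section Tower

variable (Lc : ℕ) [NeZero Lc]

/-- [our object — bookkeeping] **THE COMPOSITE SECOND-ORDER INSERTION JET OF THE `n`-FOLD AVERAGING `compRows Lc M lev rs n` ALONG A BOND WEIGHT `h` ON THE FINEST
TORUS, BY THE (♭) SECOND CHAIN RULE** (push-inside recursion as `compRows ∕ compIns₁`): `0` at depth `0`; at depth `n+1`: the top step's SECOND jet `stepIns₂` along the
TRANSPORTED direction `C_n h` (weight `θ_n∕σ_n`), composed with the lower composite averaging, PLUS TWICE the top step's first jet along `C_n h` composed with the lower
composite's first jet (weight `θ_n`; the polarised cross term of the diagonal second jet), PLUS the top step's averaging rows on the lower composite's own second jet —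
and NO top-first-jet-of-the-lower-second-jet summand (♭).  `θ_n = Lc^{d+1}·stepScale d Lc (lev 1) ∕ σ_n`, `σ_n = ∏_{i<n} stepScale d Lc (lev (i+2))·#B` (C1's letters). -/
def compIns₂ : (M : Fin (d + 1) → ℕ) → [∀ μ, NeZero (M μ)] → (lev : ℕ → ℕ) → (rs : ℕ → (Fin (d + 1) → ℕ)) → (n : ℕ) →
    ((↥(pbox (towerTorus Lc M n)) × Fin (d + 1) → ℝ)) → Matrix (↥(pbox M) × Fin (d + 1)) (↥(pbox (towerTorus Lc M n)) × Fin (d + 1)) ℝ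
  | _, _, _, _, 0, _ => 0
  | M, _, lev, rs, n + 1, h =>
    ((((Lc : ℝ) ^ (d + 1) * stepScale d Lc (lev 1)) * (∏ i ∈ range n, (stepScale d Lc (lev (i + 1 + 1)) * ((box (d + 1) Lc).card : ℝ)))⁻¹)
        * (∏ i ∈ range n, (stepScale d Lc (lev (i + 1 + 1)) * ((box (d + 1) Lc).card : ℝ)))⁻¹) •
        (stepIns₂ M Lc (rs 1) ((compRows Lc (fine Lc M) (fun k => lev (k + 1)) (fun k => rs (k + 1)) n) *ᵥ h)
          * compRows Lc (fine Lc M) (fun k => lev (k + 1)) (fun k => rs (k + 1)) n)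
      + ((2 : ℝ) * (((Lc : ℝ) ^ (d + 1) * stepScale d Lc (lev 1)) * (∏ i ∈ range n, (stepScale d Lc (lev (i + 1 + 1)) * ((box (d + 1) Lc).card : ℝ)))⁻¹)) •
        (stepIns₁ M Lc (rs 1) ((compRows Lc (fine Lc M) (fun k => lev (k + 1)) (fun k => rs (k + 1)) n) *ᵥ h)
          * compIns₁ Lc (fine Lc M) (fun k => lev (k + 1)) (fun k => rs (k + 1)) n h)
      + Qstep Lc M (lev 1) (rs 1) * compIns₂ (fine Lc M) (fun k => lev (k + 1)) (fun k => rs (k + 1)) n h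

/-- unfolding, depth `0`. -/
@[simp] theorem compIns₂_zero (M : Fin (d + 1) → ℕ) [∀ μ, NeZero (M μ)] (lev : ℕ → ℕ) (rs : ℕ → (Fin (d + 1) → ℕ)) (h : ↥(pbox M) × Fin (d + 1) → ℝ) :
    compIns₂ Lc M lev rs 0 h = 0 := rfl

/-- unfolding, depth `n+1` — TOP-PEEL BY `rfl` (the ♭ second chain rule). -/
theorem compIns₂_succ (M : Fin (d + 1) → ℕ) [∀ μ, NeZero (M μ)] (lev : ℕ → ℕ) (rs : ℕ → (Fin (d + 1) → ℕ)) (n : ℕ)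
    (h : ↥(pbox (towerTorus Lc (fine Lc M) n)) × Fin (d + 1) → ℝ) :
    compIns₂ Lc M lev rs (n + 1) h
      = ((((Lc : ℝ) ^ (d + 1) * stepScale d Lc (lev 1)) * (∏ i ∈ range n, (stepScale d Lc (lev (i + 1 + 1)) * ((box (d + 1) Lc).card : ℝ)))⁻¹)
            * (∏ i ∈ range n, (stepScale d Lc (lev (i + 1 + 1)) * ((box (d + 1) Lc).card : ℝ)))⁻¹) •
            (stepIns₂ M Lc (rs 1) ((compRows Lc (fine Lc M) (fun k => lev (k + 1)) (fun k => rs (k + 1)) n) *ᵥ h)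
              * compRows Lc (fine Lc M) (fun k => lev (k + 1)) (fun k => rs (k + 1)) n)
        + ((2 : ℝ) * (((Lc : ℝ) ^ (d + 1) * stepScale d Lc (lev 1)) * (∏ i ∈ range n, (stepScale d Lc (lev (i + 1 + 1)) * ((box (d + 1) Lc).card : ℝ)))⁻¹)) •
            (stepIns₁ M Lc (rs 1) ((compRows Lc (fine Lc M) (fun k => lev (k + 1)) (fun k => rs (k + 1)) n) *ᵥ h)
              * compIns₁ Lc (fine Lc M) (fun k => lev (k + 1)) (fun k => rs (k + 1)) n h)
        + Qstep Lc M (lev 1) (rs 1) * compIns₂ Lc (fine Lc M) (fun k => lev (k + 1)) (fun k => rs (k + 1)) n h := rfl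

/-- the one-fold composite second jet is the one-step second jet with `θ_0 = c_{lev 1}⁻¹`: `compIns₂ … 1 h = (Lc^{d+1}·stepScale d Lc (lev 1)) • stepIns₂ M Lc (rs 1) h`
(the cross term meets `compIns₁ … 0 = 0`, the last term `compIns₂ … 0 = 0`). -/
theorem compIns₂_one (M : Fin (d + 1) → ℕ) [∀ μ, NeZero (M μ)] (lev : ℕ → ℕ) (rs : ℕ → (Fin (d + 1) → ℕ)) (h : ↥(pbox (fine Lc M)) × Fin (d + 1) → ℝ) :
    compIns₂ Lc M lev rs 1 h = ((Lc : ℝ) ^ (d + 1) * stepScale d Lc (lev 1)) • stepIns₂ M Lc (rs 1) h := by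
  show ((((Lc : ℝ) ^ (d + 1) * stepScale d Lc (lev 1)) * (∏ i ∈ range 0, (stepScale d Lc (lev (i + 1 + 1)) * ((box (d + 1) Lc).card : ℝ)))⁻¹)
          * (∏ i ∈ range 0, (stepScale d Lc (lev (i + 1 + 1)) * ((box (d + 1) Lc).card : ℝ)))⁻¹) •
        (stepIns₂ M Lc (rs 1) ((1 : Matrix (↥(pbox (fine Lc M)) × Fin (d + 1)) (↥(pbox (fine Lc M)) × Fin (d + 1)) ℝ) *ᵥ h)
          * (1 : Matrix (↥(pbox (fine Lc M)) × Fin (d + 1)) (↥(pbox (fine Lc M)) × Fin (d + 1)) ℝ))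
      + ((2 : ℝ) * (((Lc : ℝ) ^ (d + 1) * stepScale d Lc (lev 1)) * (∏ i ∈ range 0, (stepScale d Lc (lev (i + 1 + 1)) * ((box (d + 1) Lc).card : ℝ)))⁻¹)) •
        (stepIns₁ M Lc (rs 1) ((1 : Matrix (↥(pbox (fine Lc M)) × Fin (d + 1)) (↥(pbox (fine Lc M)) × Fin (d + 1)) ℝ) *ᵥ h)
          * (0 : Matrix (↥(pbox (fine Lc M)) × Fin (d + 1)) (↥(pbox (fine Lc M)) × Fin (d + 1)) ℝ))
      + Qstep Lc M (lev 1) (rs 1) * (0 : Matrix (↥(pbox (fine Lc M)) × Fin (d + 1)) (↥(pbox (fine Lc M)) × Fin (d + 1)) ℝ) = _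
  rw [Matrix.mul_one, Matrix.one_mulVec, Matrix.mul_zero, Matrix.mul_zero, smul_zero, add_zero, add_zero, prod_range_zero, inv_one, mul_one, mul_one]

omit [NeZero Lc] in
/-- [folklore] the box has `Lc^{d+1}` points (cast to `ℝ`). -/
theorem card_box_cast : ((box (d + 1) Lc).card : ℝ) = (Lc : ℝ) ^ (d + 1) := by
  have hcard : (box (d + 1) Lc).card = Lc ^ (d + 1) := by simp [AffineAveraging.box, Fintype.card_piFinset]
  rw [hcard]; push_cast; rfl

/-- [folklore] **(COV-m) ORDER 2, THE INDUCTION STEP** (top peel; stated in the tower's push-inside types — `compIns₂ … (n+1)`, `compIns₁ … (n+1)`, `compRows … (n+1)`,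
`itRoot … (n+1)` UNFOLDED by `rfl`): the three summands against the finest gradient — the top step's second jet meets the COMPOSITE MASTER identity and then PART 1's
ONE-STEP law (its two tips give `2θ•stepIns₁(C h)·Far_n(C h)`, cancelled by the cross term's far part; its diagonal `−σ⁻¹•Qstep·Far_n((C h)²)` CANCELS the lower law's
far-root term carried by the top rows — this is what fixes the weight `θ_n∕σ_n`; its far root is the new one, weight `σ_{n+1}⁻¹` by `#B = Lc^{d+1}`); the cross term reads
C1's lower law; the top rows carry the lower law's tip terms to the composite tip terms. -/
theorem compIns₂_mul_tgrad_step (n : ℕ) (M : Fin (d + 1) → ℕ) [∀ μ, NeZero (M μ)] (lev : ℕ → ℕ) (rs : ℕ → (Fin (d + 1) → ℕ))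
    (hrs : ∀ k, rs k ∈ box (d + 1) Lc) (h : ↥(pbox (towerTorus Lc (fine Lc M) n)) × Fin (d + 1) → ℝ)
    (ih : compIns₂ Lc (fine Lc M) (fun k => lev (k + 1)) (fun k => rs (k + 1)) n h
        * (tgrad (towerTorus Lc (fine Lc M) n)).submatrix
            (fun b : ↥(pbox (towerTorus Lc (fine Lc M) n)) × Fin (d + 1) => ((b.1, Sum.inl b.2) : Idx (towerTorus Lc (fine Lc M) n) (Fib d))) id
      = (2 : ℝ) • (compIns₁ Lc (fine Lc M) (fun k => lev (k + 1)) (fun k => rs (k + 1)) n h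
            * Matrix.of (fun (b : ↥(pbox (towerTorus Lc (fine Lc M) n)) × Fin (d + 1)) (s : ↥(pbox (towerTorus Lc (fine Lc M) n))) =>
                h b * tdelta (towerTorus Lc (fine Lc M) n) ((b.1 : Site (d + 1)) + unitVec b.2) s))
        - compRows Lc (fine Lc M) (fun k => lev (k + 1)) (fun k => rs (k + 1)) n
            * Matrix.of (fun (b : ↥(pbox (towerTorus Lc (fine Lc M) n)) × Fin (d + 1)) (s : ↥(pbox (towerTorus Lc (fine Lc M) n))) =>
                (h b * h b) * tdelta (towerTorus Lc (fine Lc M) n) ((b.1 : Site (d + 1)) + unitVec b.2) s)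
        + (∏ i ∈ range n, (stepScale d Lc (lev (i + 1 + 1)) * ((box (d + 1) Lc).card : ℝ)))⁻¹ •
            Matrix.of (fun (a : ↥(pbox (fine Lc M)) × Fin (d + 1)) (s : ↥(pbox (towerTorus Lc (fine Lc M) n))) =>
              ((compRows Lc (fine Lc M) (fun k => lev (k + 1)) (fun k => rs (k + 1)) n *ᵥ h) a) ^ 2
                * tdelta (towerTorus Lc (fine Lc M) n)
                    ((itRoot Lc (fine Lc M) (fun k => rs (k + 1)) (fun k => hrs (k + 1)) n
                        (wrapPt (fine Lc M) ((a.1 : Site (d + 1)) + unitVec a.2)) : ↥(pbox (towerTorus Lc (fine Lc M) n))) : Site (d + 1)) s)) :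
    (((((Lc : ℝ) ^ (d + 1) * stepScale d Lc (lev 1)) * (∏ i ∈ range n, (stepScale d Lc (lev (i + 1 + 1)) * ((box (d + 1) Lc).card : ℝ)))⁻¹)
            * (∏ i ∈ range n, (stepScale d Lc (lev (i + 1 + 1)) * ((box (d + 1) Lc).card : ℝ)))⁻¹) •
            (stepIns₂ M Lc (rs 1) ((compRows Lc (fine Lc M) (fun k => lev (k + 1)) (fun k => rs (k + 1)) n) *ᵥ h)
              * compRows Lc (fine Lc M) (fun k => lev (k + 1)) (fun k => rs (k + 1)) n)
        + ((2 : ℝ) * (((Lc : ℝ) ^ (d + 1) * stepScale d Lc (lev 1)) * (∏ i ∈ range n, (stepScale d Lc (lev (i + 1 + 1)) * ((box (d + 1) Lc).card : ℝ)))⁻¹)) •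
            (stepIns₁ M Lc (rs 1) ((compRows Lc (fine Lc M) (fun k => lev (k + 1)) (fun k => rs (k + 1)) n) *ᵥ h)
              * compIns₁ Lc (fine Lc M) (fun k => lev (k + 1)) (fun k => rs (k + 1)) n h)
        + Qstep Lc M (lev 1) (rs 1) * compIns₂ Lc (fine Lc M) (fun k => lev (k + 1)) (fun k => rs (k + 1)) n h)
        * (tgrad (towerTorus Lc (fine Lc M) n)).submatrix
            (fun b : ↥(pbox (towerTorus Lc (fine Lc M) n)) × Fin (d + 1) => ((b.1, Sum.inl b.2) : Idx (towerTorus Lc (fine Lc M) n) (Fib d))) id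
      = (2 : ℝ) • (((((Lc : ℝ) ^ (d + 1) * stepScale d Lc (lev 1)) * (∏ i ∈ range n, (stepScale d Lc (lev (i + 1 + 1)) * ((box (d + 1) Lc).card : ℝ)))⁻¹) •
              (stepIns₁ M Lc (rs 1) ((compRows Lc (fine Lc M) (fun k => lev (k + 1)) (fun k => rs (k + 1)) n) *ᵥ h)
                * compRows Lc (fine Lc M) (fun k => lev (k + 1)) (fun k => rs (k + 1)) n)
            + Qstep Lc M (lev 1) (rs 1) * compIns₁ Lc (fine Lc M) (fun k => lev (k + 1)) (fun k => rs (k + 1)) n h)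
            * Matrix.of (fun (b : ↥(pbox (towerTorus Lc (fine Lc M) n)) × Fin (d + 1)) (s : ↥(pbox (towerTorus Lc (fine Lc M) n))) =>
                h b * tdelta (towerTorus Lc (fine Lc M) n) ((b.1 : Site (d + 1)) + unitVec b.2) s))
        - Qstep Lc M (lev 1) (rs 1) * compRows Lc (fine Lc M) (fun k => lev (k + 1)) (fun k => rs (k + 1)) n
            * Matrix.of (fun (b : ↥(pbox (towerTorus Lc (fine Lc M) n)) × Fin (d + 1)) (s : ↥(pbox (towerTorus Lc (fine Lc M) n))) =>
                (h b * h b) * tdelta (towerTorus Lc (fine Lc M) n) ((b.1 : Site (d + 1)) + unitVec b.2) s)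
        + (∏ i ∈ range (n + 1), (stepScale d Lc (lev (i + 1)) * ((box (d + 1) Lc).card : ℝ)))⁻¹ •
            Matrix.of (fun (a : ↥(pbox M) × Fin (d + 1)) (s : ↥(pbox (towerTorus Lc (fine Lc M) n))) =>
              (((Qstep Lc M (lev 1) (rs 1) * compRows Lc (fine Lc M) (fun k => lev (k + 1)) (fun k => rs (k + 1)) n) *ᵥ h) a) ^ 2
                * tdelta (towerTorus Lc (fine Lc M) n)
                    ((itRoot Lc (fine Lc M) (fun k => rs (k + 1)) (fun k => hrs (k + 1)) n
                        (rootPt M Lc (hrs 1) (wrapPt M ((a.1 : Site (d + 1)) + unitVec a.2))) : ↥(pbox (towerTorus Lc (fine Lc M) n))) : Site (d + 1)) s) := by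
  have hB : (box (d + 1) Lc).Nonempty := ⟨rs 0, hrs 0⟩
  have hσ := prod_stepScale_mul_card_ne_zero' Lc hB (fun i => lev (i + 1 + 1)) n
  have hLc : (Lc : ℝ) ^ (d + 1) ≠ 0 := pow_ne_zero _ (by exact_mod_cast NeZero.ne Lc)
  have hc : (Lc : ℝ) ^ (d + 1) * stepScale d Lc (lev 1) ≠ 0 := mul_ne_zero hLc (stepScale_ne_zero _)
  -- the three scalar identities: `(θ∕σ)·σ = θ`, `θ·c = σ⁻¹`, `θ·c² = σ_{n+1}⁻¹` (`#B = Lc^{d+1}`)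
  have k1 : (((Lc : ℝ) ^ (d + 1) * stepScale d Lc (lev 1)) * (∏ i ∈ range n, (stepScale d Lc (lev (i + 1 + 1)) * ((box (d + 1) Lc).card : ℝ)))⁻¹)
        * (∏ i ∈ range n, (stepScale d Lc (lev (i + 1 + 1)) * ((box (d + 1) Lc).card : ℝ)))⁻¹
        * (∏ i ∈ range n, (stepScale d Lc (lev (i + 1 + 1)) * ((box (d + 1) Lc).card : ℝ)))
      = ((Lc : ℝ) ^ (d + 1) * stepScale d Lc (lev 1)) * (∏ i ∈ range n, (stepScale d Lc (lev (i + 1 + 1)) * ((box (d + 1) Lc).card : ℝ)))⁻¹ := by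
    rw [inv_mul_cancel_right₀ hσ]
  have k2 : ((Lc : ℝ) ^ (d + 1) * stepScale d Lc (lev 1)) * (∏ i ∈ range n, (stepScale d Lc (lev (i + 1 + 1)) * ((box (d + 1) Lc).card : ℝ)))⁻¹
        * ((Lc : ℝ) ^ (d + 1) * stepScale d Lc (lev 1))⁻¹
      = (∏ i ∈ range n, (stepScale d Lc (lev (i + 1 + 1)) * ((box (d + 1) Lc).card : ℝ)))⁻¹ := by
    rw [mul_comm, ← mul_assoc, inv_mul_cancel₀ hc, one_mul]
  have k3 : ((Lc : ℝ) ^ (d + 1) * stepScale d Lc (lev 1)) * (∏ i ∈ range n, (stepScale d Lc (lev (i + 1 + 1)) * ((box (d + 1) Lc).card : ℝ)))⁻¹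
        * ((Lc : ℝ) ^ (d + 1) * stepScale d Lc (lev 1))⁻¹ ^ 2
      = (∏ i ∈ range (n + 1), (stepScale d Lc (lev (i + 1)) * ((box (d + 1) Lc).card : ℝ)))⁻¹ := by
    have hst : stepScale d Lc (lev 1) ≠ 0 := stepScale_ne_zero _
    have hσ' := hσ
    rw [card_box_cast] at hσ'
    rw [Finset.prod_range_succ', card_box_cast]
    simp only [Nat.zero_add]
    field_simp
  -- the two contact compositions through the lower tower's iterated-root indicator (`of_tdelta_mul`)
  have tipR : ∀ v : ↥(pbox (fine Lc M)) × Fin (d + 1) → ℝ,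
      Matrix.of (fun (b : ↥(pbox (fine Lc M)) × Fin (d + 1)) (t : ↥(pbox (fine Lc M))) => v b * tdelta (fine Lc M) ((b.1 : Site (d + 1)) + unitVec b.2) t)
        * Matrix.of (fun (u : ↥(pbox (fine Lc M))) (s : ↥(pbox (towerTorus Lc (fine Lc M) n))) =>
            tdelta (towerTorus Lc (fine Lc M) n)
              ((itRoot Lc (fine Lc M) (fun k => rs (k + 1)) (fun k => hrs (k + 1)) n u : ↥(pbox (towerTorus Lc (fine Lc M) n))) : Site (d + 1)) s)
      = Matrix.of (fun (a : ↥(pbox (fine Lc M)) × Fin (d + 1)) (s : ↥(pbox (towerTorus Lc (fine Lc M) n))) =>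
          v a * tdelta (towerTorus Lc (fine Lc M) n)
            ((itRoot Lc (fine Lc M) (fun k => rs (k + 1)) (fun k => hrs (k + 1)) n
                (wrapPt (fine Lc M) ((a.1 : Site (d + 1)) + unitVec a.2)) : ↥(pbox (towerTorus Lc (fine Lc M) n))) : Site (d + 1)) s) := fun v => by
    rw [of_tdelta_mul (fine Lc M)]
    rfl
  have farR : ∀ v : ↥(pbox M) × Fin (d + 1) → ℝ,
      Matrix.of (fun (a : ↥(pbox M) × Fin (d + 1)) (t : ↥(pbox (fine Lc M))) =>
          v a * tdelta (fine Lc M) ((rootPt M Lc (hrs 1) (wrapPt M ((a.1 : Site (d + 1)) + unitVec a.2)) : ↥(pbox (fine Lc M))) : Site (d + 1)) t)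
        * Matrix.of (fun (u : ↥(pbox (fine Lc M))) (s : ↥(pbox (towerTorus Lc (fine Lc M) n))) =>
            tdelta (towerTorus Lc (fine Lc M) n)
              ((itRoot Lc (fine Lc M) (fun k => rs (k + 1)) (fun k => hrs (k + 1)) n u : ↥(pbox (towerTorus Lc (fine Lc M) n))) : Site (d + 1)) s)
      = Matrix.of (fun (a : ↥(pbox M) × Fin (d + 1)) (s : ↥(pbox (towerTorus Lc (fine Lc M) n))) =>
          v a * tdelta (towerTorus Lc (fine Lc M) n)
            ((itRoot Lc (fine Lc M) (fun k => rs (k + 1)) (fun k => hrs (k + 1)) n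
                (rootPt M Lc (hrs 1) (wrapPt M ((a.1 : Site (d + 1)) + unitVec a.2))) : ↥(pbox (towerTorus Lc (fine Lc M) n))) : Site (d + 1)) s) := fun v => by
    rw [of_tdelta_mul (fine Lc M)]
    ext a s
    simp only [Matrix.of_apply, wrapPt_of_mem]
  -- summand 1: the top step's second jet along the transported direction
  have S1 : ((((Lc : ℝ) ^ (d + 1) * stepScale d Lc (lev 1)) * (∏ i ∈ range n, (stepScale d Lc (lev (i + 1 + 1)) * ((box (d + 1) Lc).card : ℝ)))⁻¹)
            * (∏ i ∈ range n, (stepScale d Lc (lev (i + 1 + 1)) * ((box (d + 1) Lc).card : ℝ)))⁻¹) •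
            (stepIns₂ M Lc (rs 1) ((compRows Lc (fine Lc M) (fun k => lev (k + 1)) (fun k => rs (k + 1)) n) *ᵥ h)
              * compRows Lc (fine Lc M) (fun k => lev (k + 1)) (fun k => rs (k + 1)) n)
        * (tgrad (towerTorus Lc (fine Lc M) n)).submatrix
            (fun b : ↥(pbox (towerTorus Lc (fine Lc M) n)) × Fin (d + 1) => ((b.1, Sum.inl b.2) : Idx (towerTorus Lc (fine Lc M) n) (Fib d))) id
      = ((2 : ℝ) * (((Lc : ℝ) ^ (d + 1) * stepScale d Lc (lev 1)) * (∏ i ∈ range n, (stepScale d Lc (lev (i + 1 + 1)) * ((box (d + 1) Lc).card : ℝ)))⁻¹)) •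
            (stepIns₁ M Lc (rs 1) ((compRows Lc (fine Lc M) (fun k => lev (k + 1)) (fun k => rs (k + 1)) n) *ᵥ h)
              * Matrix.of (fun (a : ↥(pbox (fine Lc M)) × Fin (d + 1)) (s : ↥(pbox (towerTorus Lc (fine Lc M) n))) =>
                  (compRows Lc (fine Lc M) (fun k => lev (k + 1)) (fun k => rs (k + 1)) n *ᵥ h) a
                    * tdelta (towerTorus Lc (fine Lc M) n)
                        ((itRoot Lc (fine Lc M) (fun k => rs (k + 1)) (fun k => hrs (k + 1)) n
                            (wrapPt (fine Lc M) ((a.1 : Site (d + 1)) + unitVec a.2)) : ↥(pbox (towerTorus Lc (fine Lc M) n))) : Site (d + 1)) s))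
        - (∏ i ∈ range n, (stepScale d Lc (lev (i + 1 + 1)) * ((box (d + 1) Lc).card : ℝ)))⁻¹ •
            (Qstep Lc M (lev 1) (rs 1)
              * Matrix.of (fun (a : ↥(pbox (fine Lc M)) × Fin (d + 1)) (s : ↥(pbox (towerTorus Lc (fine Lc M) n))) =>
                  ((compRows Lc (fine Lc M) (fun k => lev (k + 1)) (fun k => rs (k + 1)) n *ᵥ h) a * (compRows Lc (fine Lc M) (fun k => lev (k + 1)) (fun k => rs (k + 1)) n *ᵥ h) a)
                    * tdelta (towerTorus Lc (fine Lc M) n)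
                        ((itRoot Lc (fine Lc M) (fun k => rs (k + 1)) (fun k => hrs (k + 1)) n
                            (wrapPt (fine Lc M) ((a.1 : Site (d + 1)) + unitVec a.2)) : ↥(pbox (towerTorus Lc (fine Lc M) n))) : Site (d + 1)) s))
        + (∏ i ∈ range (n + 1), (stepScale d Lc (lev (i + 1)) * ((box (d + 1) Lc).card : ℝ)))⁻¹ •
            Matrix.of (fun (a : ↥(pbox M) × Fin (d + 1)) (s : ↥(pbox (towerTorus Lc (fine Lc M) n))) =>
              (((Qstep Lc M (lev 1) (rs 1) * compRows Lc (fine Lc M) (fun k => lev (k + 1)) (fun k => rs (k + 1)) n) *ᵥ h) a) ^ 2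
                * tdelta (towerTorus Lc (fine Lc M) n)
                    ((itRoot Lc (fine Lc M) (fun k => rs (k + 1)) (fun k => hrs (k + 1)) n
                        (rootPt M Lc (hrs 1) (wrapPt M ((a.1 : Site (d + 1)) + unitVec a.2))) : ↥(pbox (towerTorus Lc (fine Lc M) n))) : Site (d + 1)) s) := by
    rw [Matrix.smul_mul, Matrix.mul_assoc, compRows_mul_tgrad Lc n (fine Lc M) _ _ (fun k => hrs (k + 1)), Matrix.mul_smul, ← Matrix.mul_assoc,
      stepIns₂_mul_tgrad M Lc (hrs 1) (lev 1), smul_smul, k1, Matrix.add_mul, Matrix.sub_mul, Matrix.smul_mul, Matrix.smul_mul, Matrix.smul_mul,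
      Matrix.mul_assoc, Matrix.mul_assoc, tipR, tipR, farR, smul_add, smul_sub, smul_smul, smul_smul, smul_smul, k2, k3, Matrix.mulVec_mulVec,
      mul_comm (((Lc : ℝ) ^ (d + 1) * stepScale d Lc (lev 1)) * (∏ i ∈ range n, (stepScale d Lc (lev (i + 1 + 1)) * ((box (d + 1) Lc).card : ℝ)))⁻¹) (2 : ℝ)]
  -- summand 2: twice the top step's first jet on the lower composite's first jet (C1's lower law)
  have S2 : ((2 : ℝ) * (((Lc : ℝ) ^ (d + 1) * stepScale d Lc (lev 1)) * (∏ i ∈ range n, (stepScale d Lc (lev (i + 1 + 1)) * ((box (d + 1) Lc).card : ℝ)))⁻¹)) •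
            (stepIns₁ M Lc (rs 1) ((compRows Lc (fine Lc M) (fun k => lev (k + 1)) (fun k => rs (k + 1)) n) *ᵥ h)
              * compIns₁ Lc (fine Lc M) (fun k => lev (k + 1)) (fun k => rs (k + 1)) n h)
        * (tgrad (towerTorus Lc (fine Lc M) n)).submatrix
            (fun b : ↥(pbox (towerTorus Lc (fine Lc M) n)) × Fin (d + 1) => ((b.1, Sum.inl b.2) : Idx (towerTorus Lc (fine Lc M) n) (Fib d))) id
      = ((2 : ℝ) * (((Lc : ℝ) ^ (d + 1) * stepScale d Lc (lev 1)) * (∏ i ∈ range n, (stepScale d Lc (lev (i + 1 + 1)) * ((box (d + 1) Lc).card : ℝ)))⁻¹)) •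
            (stepIns₁ M Lc (rs 1) ((compRows Lc (fine Lc M) (fun k => lev (k + 1)) (fun k => rs (k + 1)) n) *ᵥ h)
              * (compRows Lc (fine Lc M) (fun k => lev (k + 1)) (fun k => rs (k + 1)) n
                * Matrix.of (fun (b : ↥(pbox (towerTorus Lc (fine Lc M) n)) × Fin (d + 1)) (s : ↥(pbox (towerTorus Lc (fine Lc M) n))) =>
                    h b * tdelta (towerTorus Lc (fine Lc M) n) ((b.1 : Site (d + 1)) + unitVec b.2) s)))
        - ((2 : ℝ) * (((Lc : ℝ) ^ (d + 1) * stepScale d Lc (lev 1)) * (∏ i ∈ range n, (stepScale d Lc (lev (i + 1 + 1)) * ((box (d + 1) Lc).card : ℝ)))⁻¹)) •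
            (stepIns₁ M Lc (rs 1) ((compRows Lc (fine Lc M) (fun k => lev (k + 1)) (fun k => rs (k + 1)) n) *ᵥ h)
              * Matrix.of (fun (a : ↥(pbox (fine Lc M)) × Fin (d + 1)) (s : ↥(pbox (towerTorus Lc (fine Lc M) n))) =>
                  (compRows Lc (fine Lc M) (fun k => lev (k + 1)) (fun k => rs (k + 1)) n *ᵥ h) a
                    * tdelta (towerTorus Lc (fine Lc M) n)
                        ((itRoot Lc (fine Lc M) (fun k => rs (k + 1)) (fun k => hrs (k + 1)) n
                            (wrapPt (fine Lc M) ((a.1 : Site (d + 1)) + unitVec a.2)) : ↥(pbox (towerTorus Lc (fine Lc M) n))) : Site (d + 1)) s)) := by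
    rw [Matrix.smul_mul, Matrix.mul_assoc, compIns₁_mul_tgrad Lc n (fine Lc M) _ _ (fun k => hrs (k + 1)) h, Matrix.mul_sub, smul_sub]
  rw [Matrix.add_mul, Matrix.add_mul, S1, S2, Matrix.mul_assoc, ih, Matrix.mul_add, Matrix.mul_sub, Matrix.mul_smul, Matrix.mul_smul, Matrix.add_mul,
    Matrix.smul_mul, smul_add, smul_smul, Matrix.mul_assoc, Matrix.mul_assoc, Matrix.mul_assoc]
  have e2 : Matrix.of (fun (a : ↥(pbox (fine Lc M)) × Fin (d + 1)) (s : ↥(pbox (towerTorus Lc (fine Lc M) n))) =>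
        ((compRows Lc (fine Lc M) (fun k => lev (k + 1)) (fun k => rs (k + 1)) n *ᵥ h) a * (compRows Lc (fine Lc M) (fun k => lev (k + 1)) (fun k => rs (k + 1)) n *ᵥ h) a)
          * tdelta (towerTorus Lc (fine Lc M) n)
              ((itRoot Lc (fine Lc M) (fun k => rs (k + 1)) (fun k => hrs (k + 1)) n
                  (wrapPt (fine Lc M) ((a.1 : Site (d + 1)) + unitVec a.2)) : ↥(pbox (towerTorus Lc (fine Lc M) n))) : Site (d + 1)) s)
      = Matrix.of (fun (a : ↥(pbox (fine Lc M)) × Fin (d + 1)) (s : ↥(pbox (towerTorus Lc (fine Lc M) n))) =>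
        ((compRows Lc (fine Lc M) (fun k => lev (k + 1)) (fun k => rs (k + 1)) n *ᵥ h) a) ^ 2
          * tdelta (towerTorus Lc (fine Lc M) n)
              ((itRoot Lc (fine Lc M) (fun k => rs (k + 1)) (fun k => hrs (k + 1)) n
                  (wrapPt (fine Lc M) ((a.1 : Site (d + 1)) + unitVec a.2)) : ↥(pbox (towerTorus Lc (fine Lc M) n))) : Site (d + 1)) s) := by
    ext a s; rw [Matrix.of_apply, Matrix.of_apply, sq]
  rw [e2]
  abel

/-- [folklore] **`compIns₂_mul_tgrad` — (COV-m) ORDER 2: THE COMPOSITE SECOND-ORDER INSERTION JET's GAUGE-COVARIANCE LAW ON ALL COLUMNS, AT EVERY DEPTH**: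
`compIns₂ … n h · D_finest = 2 • (compIns₁ … n h · Tip(h)) − compRows … n · Tip(h⊙h) + σ_n⁻¹ • Far_n((compRows … n · h)⊙(compRows … n · h))` — `Tip(v)(b, s) = v b · [s ≡
b.1 + e_{b.2}]` (tip contact on the finest torus), `Far_n(v)(a, s) = v a · [s = itRoot n (a.1 + e_{a.2})]` (contact at the ITERATED ROOT of the far endpoint of the top
bond `a`), `σ_n = ∏_{i<n} stepScale d Lc (lev (i+1))·#B`.  Depth `0`: `0 = 0 − Tip(h⊙h) + Tip(h⊙h)`; the step is `compIns₂_mul_tgrad_step`.  PART 3 reads this through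
the tower generators (`towerGen = D_finest · evalN`): the tip terms are `−2•Q₁₁·W₁ − Q₁₀·W₂`, the far-root term on the top block is the coarse jet `D̄₂ = σ⁻¹c²(Q₁₀h)²[tip]`,
on the lower blocks it VANISHES — the door's `c2` with the PURE SQUARE. -/
theorem compIns₂_mul_tgrad :
    ∀ (n : ℕ) (M : Fin (d + 1) → ℕ) [∀ μ, NeZero (M μ)] (lev : ℕ → ℕ) (rs : ℕ → (Fin (d + 1) → ℕ)) (hrs : ∀ k, rs k ∈ box (d + 1) Lc)
      (h : ↥(pbox (towerTorus Lc M n)) × Fin (d + 1) → ℝ),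
      compIns₂ Lc M lev rs n h
          * (tgrad (towerTorus Lc M n)).submatrix
              (fun b : ↥(pbox (towerTorus Lc M n)) × Fin (d + 1) => ((b.1, Sum.inl b.2) : Idx (towerTorus Lc M n) (Fib d))) id
        = (2 : ℝ) • (compIns₁ Lc M lev rs n h
              * Matrix.of (fun (b : ↥(pbox (towerTorus Lc M n)) × Fin (d + 1)) (s : ↥(pbox (towerTorus Lc M n))) =>
                  h b * tdelta (towerTorus Lc M n) ((b.1 : Site (d + 1)) + unitVec b.2) s))
          - compRows Lc M lev rs n
              * Matrix.of (fun (b : ↥(pbox (towerTorus Lc M n)) × Fin (d + 1)) (s : ↥(pbox (towerTorus Lc M n))) =>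
                  (h b * h b) * tdelta (towerTorus Lc M n) ((b.1 : Site (d + 1)) + unitVec b.2) s)
          + (∏ i ∈ range n, (stepScale d Lc (lev (i + 1)) * ((box (d + 1) Lc).card : ℝ)))⁻¹ •
              Matrix.of (fun (a : ↥(pbox M) × Fin (d + 1)) (s : ↥(pbox (towerTorus Lc M n))) =>
                ((compRows Lc M lev rs n *ᵥ h) a) ^ 2
                  * tdelta (towerTorus Lc M n) ((itRoot Lc M rs hrs n (wrapPt M ((a.1 : Site (d + 1)) + unitVec a.2)) : ↥(pbox (towerTorus Lc M n))) : Site (d + 1)) s)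
  | 0, M, _, lev, rs, hrs, h => by
    show (0 : Matrix (↥(pbox M) × Fin (d + 1)) (↥(pbox M) × Fin (d + 1)) ℝ)
          * (tgrad M).submatrix (fun b : ↥(pbox M) × Fin (d + 1) => ((b.1, Sum.inl b.2) : Idx M (Fib d))) id
        = (2 : ℝ) • ((0 : Matrix (↥(pbox M) × Fin (d + 1)) (↥(pbox M) × Fin (d + 1)) ℝ)
              * Matrix.of (fun (b : ↥(pbox M) × Fin (d + 1)) (s : ↥(pbox M)) => h b * tdelta M ((b.1 : Site (d + 1)) + unitVec b.2) s))
          - (1 : Matrix (↥(pbox M) × Fin (d + 1)) (↥(pbox M) × Fin (d + 1)) ℝ)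
              * Matrix.of (fun (b : ↥(pbox M) × Fin (d + 1)) (s : ↥(pbox M)) => (h b * h b) * tdelta M ((b.1 : Site (d + 1)) + unitVec b.2) s)
          + (∏ i ∈ range 0, (stepScale d Lc (lev (i + 1)) * ((box (d + 1) Lc).card : ℝ)))⁻¹ •
              Matrix.of (fun (a : ↥(pbox M) × Fin (d + 1)) (s : ↥(pbox M)) =>
                (((1 : Matrix (↥(pbox M) × Fin (d + 1)) (↥(pbox M) × Fin (d + 1)) ℝ) *ᵥ h) a) ^ 2
                  * tdelta M ((wrapPt M ((a.1 : Site (d + 1)) + unitVec a.2) : ↥(pbox M)) : Site (d + 1)) s)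
    rw [Matrix.zero_mul, Matrix.zero_mul, smul_zero, Matrix.one_mul, Matrix.one_mulVec, prod_range_zero, inv_one, one_smul, zero_sub, eq_comm,
      neg_add_eq_zero]
    ext a s
    rw [Matrix.of_apply, Matrix.of_apply, tdelta_wrapPt, sq]
  | n + 1, M, _, lev, rs, hrs, h =>
    compIns₂_mul_tgrad_step Lc n M lev rs hrs h (compIns₂_mul_tgrad n (fine Lc M) (fun k => lev (k + 1)) (fun k => rs (k + 1)) (fun k => hrs (k + 1)) h)

end Tower

end Summit.QuantumFields.BalabanUV.Beta.FP.TorusCompositeCovarianceTwo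

end
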